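import Literature.Analysis.FluidPDE.SelfSimilarEulerEnergyLowerBound
import Literature.Analysis.FluidPDE.SelfSimilarEulerPressureRecovery
import HarnessLib

/-!
# Bronzi–Shvydkoy 2015, Remark 1.2: the local energy dimension `3 − 2α` of a locally
# self-similar Euler blow-up (kernel form, `L^p` class)

Analysis/FluidPDE proof file (theorems only; no definitions, no named facts, no `sorry`), the
capstone of `SelfSimilarEulerEnergyLowerBound.lean` (BS15 Thm 1.1 for `L^p` profiles: the
two-sided law `∫_{|y|<L}|v|² ≍ L^{3−2α}`) and `SelfSimilarEulerPressureRecovery.lean` (BS15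
Lemma 2.1 Step 3 and (1.5)/(1.6) for an ambient exact collapse in the Beale–Kato–Majda class),
in PHYSICAL variables.

BS15 Remark 1.2 (held text arXiv:1310.8611 p. 3): "In view of (1.5), the conclusion of the
theorem states that unless the profile `v` is trivial, the self-similar blowup carries some
positive amount of energy with it, i.e. `‖u(t)‖_{L²(B_{ρ₀}(x₀))}` stays bounded away from zero as
time `t` approaches critical. … As a consequence of (1.8),
`𝓔_T(B_ρ(x₀)) ∼ lim_{L→∞} L^{2α−N} ∫_{|y|<ρL}|v(y)|² dy ∼ ρ^{N−2α}` for all small `ρ`. This implies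
that in the case of non-trivial self-similar blow-up satisfying (1.7) the exact fractal local
dimension of `𝓔_T` exists at `x₀` and is equal to `D = N − 2α`."  Here (1.5) is the exact scaling
`‖u(t)‖²_{L²(B_ρ(x₀))} = (T−t)^{2(γ−1)+3γ} ∫_{|y|<ρ(T−t)^{−γ}} |v|²`, `γ = 1/(α+1)` (the tree's
`setIntegral_norm_sq_selfSimilarCollapse_ball`).

Kernel rendering (`N = 3`, no energy measure is introduced — the statements are about
`∫_{B_ρ(x₀)}|u(t)|²` for `t` near `T`, which is what the weak-* limit measures):

* `localEnergy_eq_of_locallySelfSimilar` — (1.5) on every ball `B_ρ(x₀)`, `ρ ≤ ρ₀`;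
* `localEnergy_le_of_locallySelfSimilar` — UPPER: in the BKM class,
  `∫_{B_ρ(x₀)}|u(t)|² ≤ ‖u(0)‖²₂ ρ₀^{2α−3} ρ^{3−2α}` for `0 < ρ ≤ ρ₀` and `t` close to `T`
  (`T − t ≤ T (ρ/ρ₀)^{α+1}`), any `α > −1` (from `energyGrowth_of_locallySelfSimilar`);
* `localEnergy_ge_of_selfSimilarCollapse_of_memLp` — LOWER, uniform constant: if the profile
  `(v, q)` is a non-trivial `L^p × L^{p/2}` solution of the profile system in the window
  `3/p < α ≤ 3/2` (`3 ≤ p < ∞`), there is ONE `c > 0` with `∫_{B_ρ(x₀)}|u(t)|² ≥ c ρ^{3−2α}` for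
  every `0 < ρ ≤ ρ₀` and all `t` close to `T` (depending on `ρ`) — for ANY field `u` equal to the
  collapse on the ball (from `bronziShvydkoy2015_dichotomy_of_memLp`);
* `localEnergy_two_sided_of_locallySelfSimilar_of_memLp` — **BS15 Rem 1.2, local dimension
  `3 − 2α`**: both together for an exact locally self-similar collapse of a classical Euler
  solution in the BKM class whose profile pair is in `L^p × L^{p/2}` and non-trivial:
  `c ρ^{3−2α} ≤ ∫_{B_ρ(x₀)}|u(t)|² ≤ C ρ^{3−2α}` for every small ball, eventually in `t`.

Census reading (ns-blowup zones Z5–Z8, exact-collapse hooks): with `c_l = γ = 1/(1+α)` the local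
energy captured in a ball of radius `ρ` about the collapse point scales EXACTLY like
`ρ^{5 − 2/c_l}` as `t → T` (`ρ¹` in Leray's gauge `c_l = ½`); a claimed exact `L^p`-class
collapse must print this two-sided law. The pressure profile `q` of an exact collapse exists by
`exists_pressureProfile_of_locallySelfSimilar`; only its integrability is a hypothesis.

## Mathlib / tree search

`lean search 'localEnergy_|energy_ball_lower_bound|energyMeasure'`: the tree has the
fact-conditional `bronziShvydkoy2015_energy_dichotomy.energy_ball_lower_bound`
(`SelfSimilarEulerEnergyConcentration.lean`) and, since 2026-08-27, the fact-free
`energy_ball_lower_bound_of_selfSimilarCollapse_of_memLp` at the radius `ρ₀`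
(`SelfSimilarEulerEnergyLowerBound.lean`); no small-ball / two-sided statement. Reused:
`setIntegral_norm_sq_selfSimilarCollapse_ball`, `bronziShvydkoy2015_dichotomy_of_memLp`,
`energyGrowth_of_locallySelfSimilar`; Mathlib `integral_indicator`, `integral_sub_right_eq_self`,
`Real.rpow_*`. No new definitions, no instances, no notation.

## References

* A. Bronzi, R. Shvydkoy, Indiana Univ. Math. J. 64 (2015) 1291–1302 = arXiv:1310.8611, §1
  eq. (1.5), Thm. 1.1, Rem. 1.2. [BronziShvydkoy2015]
-/

noncomputable section

open MeasureTheory Set Filter Topology Metric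
open scoped ENNReal NNReal

namespace Literature.Analysis.FluidPDE

section LocalEnergy

variable {γ α T ρ₀ : ℝ} {x₀ : EuclideanSpace ℝ (Fin 3)}
  {u : ℝ → EuclideanSpace ℝ (Fin 3) → EuclideanSpace ℝ (Fin 3)}
  {p : ℝ → EuclideanSpace ℝ (Fin 3) → ℝ}
  {v : EuclideanSpace ℝ (Fin 3) → EuclideanSpace ℝ (Fin 3)} {q : EuclideanSpace ℝ (Fin 3) → ℝ}

/-- Translating a ball integral: `∫_{B_ρ(x₀)} f(x − x₀) dx = ∫_{B_ρ(0)} f(z) dz`. [folklore] -/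
private theorem setIntegral_comp_sub_ball_loc (f : EuclideanSpace ℝ (Fin 3) → ℝ)
    (x₀ : EuclideanSpace ℝ (Fin 3)) (ρ : ℝ) :
    ∫ x in ball x₀ ρ, f (x - x₀) = ∫ z in ball (0 : EuclideanSpace ℝ (Fin 3)) ρ, f z := by
  rw [← integral_indicator measurableSet_ball, ← integral_indicator measurableSet_ball]
  have hind : (ball x₀ ρ).indicator (fun x => f (x - x₀)) =
      fun x => (ball (0 : EuclideanSpace ℝ (Fin 3)) ρ).indicator f (x - x₀) := by
    funext x
    have hmem : x ∈ ball x₀ ρ ↔ x - x₀ ∈ ball (0 : EuclideanSpace ℝ (Fin 3)) ρ := by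
      rw [mem_ball, mem_ball, dist_eq_norm, dist_zero_right]
    by_cases hx : x ∈ ball x₀ ρ
    · rw [indicator_of_mem hx, indicator_of_mem (hmem.1 hx)]
    · rw [indicator_of_notMem hx, indicator_of_notMem (fun h => hx (hmem.2 h))]
  rw [hind]
  exact integral_sub_right_eq_self _ x₀

/-- **BS15 (1.5) on every sub-ball.** If `u(t,x) = (T−t)^{γ−1} v((T−t)^{−γ}(x − x₀))` on
`B_{ρ₀}(x₀) × [0,T)`, then for `0 ≤ t < T` and `ρ ≤ ρ₀`,
`∫_{B_ρ(x₀)} |u(t,x)|² dx = (T−t)^{2(γ−1)+3γ} ∫_{|y| < ρ(T−t)^{−γ}} |v(y)|² dy`.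
[cite: BronziShvydkoy2015, §1 eq. (1.5)] -/
theorem localEnergy_eq_of_locallySelfSimilar
    (hss : ∀ t ∈ Ico 0 T, ∀ x ∈ ball x₀ ρ₀, u t x = selfSimilarCollapse γ T v t (x - x₀))
    {t ρ : ℝ} (ht : t ∈ Ico 0 T) (hρ : ρ ≤ ρ₀) :
    ∫ x in ball x₀ ρ, ‖u t x‖ ^ 2 =
      (T - t) ^ (2 * (γ - 1) + 3 * γ) *
        ∫ y in ball (0 : EuclideanSpace ℝ (Fin 3)) (ρ * (T - t) ^ (-γ)), ‖v y‖ ^ 2 := by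
  have hball : ∫ x in ball x₀ ρ, ‖u t x‖ ^ 2 =
      ∫ x in ball x₀ ρ, ‖selfSimilarCollapse γ T v t (x - x₀)‖ ^ 2 := by
    refine setIntegral_congr_fun measurableSet_ball fun x hx => ?_
    rw [hss t ht x (ball_subset_ball hρ hx)]
  rw [hball, setIntegral_comp_sub_ball_loc (fun z => ‖selfSimilarCollapse γ T v t z‖ ^ 2) x₀ ρ,
    setIntegral_norm_sq_selfSimilarCollapse_ball ht.2 v ρ]

/-- The exponent bookkeeping of (1.5): with `γ = 1/(α+1)`,
`(T−t)^{2(γ−1)+3γ} (ρ (T−t)^{−γ})^{3−2α} = ρ^{3−2α}`. [cite: BronziShvydkoy2015, §1 eq. (1.5)] -/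
theorem collapse_scaling_identity (hα : -1 < α) {t ρ : ℝ} (ht : t < T) (hρ : 0 < ρ) :
    (T - t) ^ (2 * (1 / (α + 1) - 1) + 3 * (1 / (α + 1))) *
        (ρ * (T - t) ^ (-(1 / (α + 1)))) ^ (3 - 2 * α) = ρ ^ (3 - 2 * α) := by
  have hs : 0 < T - t := sub_pos.mpr ht
  have hα1 : 0 < α + 1 := by linarith
  rw [Real.mul_rpow hρ.le (Real.rpow_pos_of_pos hs _).le, ← Real.rpow_mul hs.le, mul_left_comm,
    ← Real.rpow_add hs]
  have : 2 * (1 / (α + 1) - 1) + 3 * (1 / (α + 1)) + -(1 / (α + 1)) * (3 - 2 * α) = 0 := by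
    field_simp; ring
  rw [this, Real.rpow_zero, mul_one]

/-- For `0 < ρ`, `0 < s ≤ T₀ (ρ/M)^{α+1}` (`M, T₀ > 0`, `α > −1`) the rescaled radius satisfies
`M T₀^{−1/(α+1)} ≤ ρ s^{−1/(α+1)}`. [folklore] -/
private theorem rescaledRadius_ge (hα : -1 < α) {M T₀ s ρ : ℝ} (hM : 0 < M) (hT₀ : 0 < T₀)
    (hs : 0 < s) (hρ : 0 < ρ) (hsle : s ≤ T₀ * (ρ / M) ^ (α + 1)) :
    M * T₀ ^ (-(1 / (α + 1))) ≤ ρ * s ^ (-(1 / (α + 1))) := by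
  have hα1 : 0 < α + 1 := by linarith
  have hγ : 0 < 1 / (α + 1) := by positivity
  have hρM : 0 < ρ / M := div_pos hρ hM
  -- `s^{-γ} ≥ (T₀ (ρ/M)^{α+1})^{-γ} = T₀^{-γ} · M/ρ`
  have h1 : (T₀ * (ρ / M) ^ (α + 1)) ^ (-(1 / (α + 1))) ≤ s ^ (-(1 / (α + 1))) :=
    Real.rpow_le_rpow_of_nonpos hs hsle (by linarith)
  have h2 : (T₀ * (ρ / M) ^ (α + 1)) ^ (-(1 / (α + 1))) = T₀ ^ (-(1 / (α + 1))) * (M / ρ) := by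
    rw [Real.mul_rpow hT₀.le (Real.rpow_pos_of_pos hρM _).le, ← Real.rpow_mul hρM.le]
    have : (α + 1) * -(1 / (α + 1)) = -1 := by field_simp
    rw [this, Real.rpow_neg_one, inv_div]
  rw [h2] at h1
  calc M * T₀ ^ (-(1 / (α + 1))) = ρ * (T₀ ^ (-(1 / (α + 1))) * (M / ρ)) := by
        field_simp
    _ ≤ ρ * s ^ (-(1 / (α + 1))) := by gcongr

/-- **UPPER bound on every small ball (BKM class).** For a classical finite-energy Euler solution on
`[0,T)` with bounded Sobolev norms on every `[0,T'']`, `T'' < T`, locally self-similar on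
`B_{ρ₀}(x₀)` with exponent `γ = 1/(α+1)`, `α > −1`: for `0 < ρ ≤ ρ₀` and `0 ≤ t < T` with
`T − t ≤ T (ρ/ρ₀)^{α+1}`, `∫_{B_ρ(x₀)} |u(t)|² ≤ ‖u(0)‖²_{L²} ρ₀^{2α−3} ρ^{3−2α}` (from
`energyGrowth_of_locallySelfSimilar`, BS15 (1.6), and (1.5)).
[cite: BronziShvydkoy2015, §1 eqs. (1.5)–(1.6) and Rem. 1.2] -/
theorem localEnergy_le_of_locallySelfSimilar (hT : 0 < T) (hα : -1 < α) (hρ₀ : 0 < ρ₀)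
    (hsol : IsClassicalEulerSolutionOn (Ico 0 T) 0 u p)
    (hreg : ∀ T'' < T, HasBoundedSobolevNormsOn (Icc 0 T'') u)
    (hss : ∀ t ∈ Ico 0 T, ∀ x ∈ ball x₀ ρ₀,
      u t x = selfSimilarCollapse (1 / (α + 1)) T v t (x - x₀))
    {t ρ : ℝ} (ht : t ∈ Ico 0 T) (hρ : 0 < ρ) (hρle : ρ ≤ ρ₀)
    (hclose : T - t ≤ T * (ρ / ρ₀) ^ (α + 1)) :
    ∫ x in ball x₀ ρ, ‖u t x‖ ^ 2 ≤
      (∫ x, ‖u 0 x‖ ^ 2) * ρ₀ ^ (2 * α - 3) * ρ ^ (3 - 2 * α) := by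
  have hs : 0 < T - t := sub_pos.mpr ht.2
  set L : ℝ := ρ * (T - t) ^ (-(1 / (α + 1))) with hL_def
  have hL : ρ₀ * T ^ (-(1 / (α + 1))) ≤ L := rescaledRadius_ge hα hρ₀ hT hs hρ hclose
  have hgrowth := energyGrowth_of_locallySelfSimilar hT hα hρ₀ hsol hreg hss hL
  have hpre : 0 < (T - t) ^ (2 * (1 / (α + 1) - 1) + 3 * (1 / (α + 1))) :=
    Real.rpow_pos_of_pos hs _
  rw [localEnergy_eq_of_locallySelfSimilar hss ht hρle]
  calc (T - t) ^ (2 * (1 / (α + 1) - 1) + 3 * (1 / (α + 1))) *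
        ∫ y in ball (0 : EuclideanSpace ℝ (Fin 3)) (ρ * (T - t) ^ (-(1 / (α + 1)))), ‖v y‖ ^ 2
      ≤ (T - t) ^ (2 * (1 / (α + 1) - 1) + 3 * (1 / (α + 1))) *
          ((∫ x, ‖u 0 x‖ ^ 2) * ρ₀ ^ (2 * α - 3) * L ^ (3 - 2 * α)) :=
        mul_le_mul_of_nonneg_left hgrowth hpre.le
    _ = (∫ x, ‖u 0 x‖ ^ 2) * ρ₀ ^ (2 * α - 3) *
          ((T - t) ^ (2 * (1 / (α + 1) - 1) + 3 * (1 / (α + 1))) * L ^ (3 - 2 * α)) := by ring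
    _ = (∫ x, ‖u 0 x‖ ^ 2) * ρ₀ ^ (2 * α - 3) * ρ ^ (3 - 2 * α) := by
        rw [hL_def, collapse_scaling_identity hα ht.2 hρ]

/-- **LOWER bound on every small ball, uniform constant (`L^p` class, no equation for `u`).** Let
`(v, q)` be a non-trivial stationary self-similar Euler profile with exponent `γ = 1/(α+1)`,
`v ∈ L^p`, `q ∈ L^{p/2}`, `3 ≤ p < ∞`, `3/p < α ≤ 3/2`, and let `u` equal the collapse of `v` on
`B_{ρ₀}(x₀) × [0,T)`. Then there are `c > 0` and `M > 0` such that for every `0 < ρ ≤ ρ₀` and every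
`0 ≤ t < T` with `T − t ≤ T (ρ/M)^{α+1}` (a closeness threshold depending on `ρ`) one has
`c ρ^{3−2α} ≤ ∫_{B_ρ(x₀)} |u(t)|²`, with `c` INDEPENDENT of `ρ` (the lower half of BS15 (1.8) via
`bronziShvydkoy2015_dichotomy_of_memLp`, and (1.5)).
[cite: BronziShvydkoy2015, §1 Thm. 1.1 and Rem. 1.2] -/
theorem localEnergy_ge_of_selfSimilarCollapse_of_memLp (p' : ℝ≥0∞)
    (h3 : 3 ≤ p') (htop : p' ≠ ∞) (hαp : 3 / p'.toReal < α) (hα2 : α ≤ 3 / 2)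
    (hprof : IsSelfSimilarEulerProfile (1 / (α + 1)) 0 v q)
    (hU : MemLp v p' volume) (hP : MemLp q (p' / 2) volume)
    (hT : 0 < T)
    (hss : ∀ t ∈ Ico 0 T, ∀ x ∈ ball x₀ ρ₀,
      u t x = selfSimilarCollapse (1 / (α + 1)) T v t (x - x₀))
    (hv : v ≠ 0) :
    ∃ c M : ℝ, 0 < c ∧ 0 < M ∧ ∀ ρ : ℝ, 0 < ρ → ρ ≤ ρ₀ → ∀ t ∈ Ico 0 T,
      T - t ≤ T * (ρ / M) ^ (α + 1) → c * ρ ^ (3 - 2 * α) ≤ ∫ x in ball x₀ ρ, ‖u t x‖ ^ 2 := by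
  obtain ⟨c, C, L₀, hc, hbd⟩ :=
    (bronziShvydkoy2015_dichotomy_of_memLp α p' v q h3 htop hαp hα2 hprof hU hP).resolve_left hv
  have hα0 : 0 < α := by
    have : 0 ≤ 3 / p'.toReal := div_nonneg (by norm_num) ENNReal.toReal_nonneg
    linarith
  have hα : -1 < α := by linarith
  -- `M := max L₀ 1 · T^{γ}` so that `M T^{-γ} = max L₀ 1`
  set M : ℝ := max L₀ 1 * T ^ (1 / (α + 1)) with hM_def
  have hM1 : 0 < max L₀ 1 := lt_of_lt_of_le one_pos (le_max_right _ _)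
  have hM : 0 < M := mul_pos hM1 (Real.rpow_pos_of_pos hT _)
  refine ⟨c, M, hc, hM, fun ρ hρ hρle t ht hclose => ?_⟩
  have hs : 0 < T - t := sub_pos.mpr ht.2
  set L : ℝ := ρ * (T - t) ^ (-(1 / (α + 1))) with hL_def
  have hL1 : M * T ^ (-(1 / (α + 1))) ≤ L := rescaledRadius_ge hα hM hT hs hρ hclose
  have hMT : M * T ^ (-(1 / (α + 1))) = max L₀ 1 := by
    rw [hM_def, mul_assoc, ← Real.rpow_add hT, add_neg_cancel, Real.rpow_zero, mul_one]
  have hL₀L : L₀ ≤ L := (le_max_left _ _).trans (hMT ▸ hL1)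
  have hlow : c * L ^ (3 - 2 * α) ≤
      ∫ y in ball (0 : EuclideanSpace ℝ (Fin 3)) L, ‖v y‖ ^ 2 := (hbd L hL₀L).1
  have hpre : 0 < (T - t) ^ (2 * (1 / (α + 1) - 1) + 3 * (1 / (α + 1))) :=
    Real.rpow_pos_of_pos hs _
  -- the ansatz holds on the smaller ball as well
  have hss' : ∀ t ∈ Ico 0 T, ∀ x ∈ ball x₀ ρ,
      u t x = selfSimilarCollapse (1 / (α + 1)) T v t (x - x₀) := fun t ht x hx =>
    hss t ht x (ball_subset_ball hρle hx)
  rw [localEnergy_eq_of_locallySelfSimilar hss' ht le_rfl]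
  calc c * ρ ^ (3 - 2 * α)
      = (T - t) ^ (2 * (1 / (α + 1) - 1) + 3 * (1 / (α + 1))) * (c * L ^ (3 - 2 * α)) := by
        rw [hL_def, ← collapse_scaling_identity hα ht.2 hρ]; ring
    _ ≤ (T - t) ^ (2 * (1 / (α + 1) - 1) + 3 * (1 / (α + 1))) *
          ∫ y in ball (0 : EuclideanSpace ℝ (Fin 3)) L, ‖v y‖ ^ 2 :=
        mul_le_mul_of_nonneg_left hlow hpre.le

/-- **BS15 Remark 1.2 — the local energy dimension is exactly `3 − 2α` (kernel form, `L^p`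
class).** Let `u` be a classical finite-energy Euler solution on `[0,T)` in the Beale–Kato–Majda
class, exactly locally self-similar on `B_{ρ₀}(x₀)` with exponent `γ = 1/(α+1)` and profile `v`, and
let `q` be a pressure profile with `IsSelfSimilarEulerProfile γ 0 v q` (it exists:
`exists_pressureProfile_of_locallySelfSimilar`) such that `v ∈ L^p`, `q ∈ L^{p/2}`, `3 ≤ p < ∞`,
`3/p < α ≤ 3/2`, `v ≠ 0`. Then there are constants `0 < c`, `C` and `M > 0` such that for every
ball `B_ρ(x₀)`, `0 < ρ ≤ ρ₀`, and all `t ∈ [0,T)` with `T − t ≤ T (ρ/M)^{α+1}`: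
`c ρ^{3−2α} ≤ ∫_{B_ρ(x₀)} |u(t,x)|² dx ≤ C ρ^{3−2α}` ("`𝓔_T(B_ρ(x₀)) ∼ ρ^{N−2α}` for all small `ρ` …
the exact fractal local dimension of `𝓔_T` exists at `x₀` and is equal to `D = N − 2α`").
[cite: BronziShvydkoy2015, §1 Rem. 1.2 (with Thm. 1.1, eqs. (1.5)–(1.6))] -/
theorem localEnergy_two_sided_of_locallySelfSimilar_of_memLp (p' : ℝ≥0∞)
    (h3 : 3 ≤ p') (htop : p' ≠ ∞) (hαp : 3 / p'.toReal < α) (hα2 : α ≤ 3 / 2)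
    (hT : 0 < T) (hρ₀ : 0 < ρ₀)
    (hsol : IsClassicalEulerSolutionOn (Ico 0 T) 0 u p)
    (hreg : ∀ T'' < T, HasBoundedSobolevNormsOn (Icc 0 T'') u)
    (hss : ∀ t ∈ Ico 0 T, ∀ x ∈ ball x₀ ρ₀,
      u t x = selfSimilarCollapse (1 / (α + 1)) T v t (x - x₀))
    (hprof : IsSelfSimilarEulerProfile (1 / (α + 1)) 0 v q)
    (hU : MemLp v p' volume) (hP : MemLp q (p' / 2) volume) (hv : v ≠ 0) :
    ∃ c C M : ℝ, 0 < c ∧ c ≤ C ∧ 0 < M ∧ ∀ ρ : ℝ, 0 < ρ → ρ ≤ ρ₀ → ∀ t ∈ Ico 0 T,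
      T - t ≤ T * (ρ / M) ^ (α + 1) →
        c * ρ ^ (3 - 2 * α) ≤ ∫ x in ball x₀ ρ, ‖u t x‖ ^ 2 ∧
          ∫ x in ball x₀ ρ, ‖u t x‖ ^ 2 ≤ C * ρ ^ (3 - 2 * α) := by
  have hα0 : 0 < α := by
    have : 0 ≤ 3 / p'.toReal := div_nonneg (by norm_num) ENNReal.toReal_nonneg
    linarith
  have hα : -1 < α := by linarith
  have hα1 : 0 < α + 1 := by linarith
  obtain ⟨c, M, hc, hM, hlow⟩ :=
    localEnergy_ge_of_selfSimilarCollapse_of_memLp (ρ₀ := ρ₀) p' h3 htop hαp hα2 hprof hU hP hT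
      hss hv
  set K : ℝ := (∫ x, ‖u 0 x‖ ^ 2) * ρ₀ ^ (2 * α - 3) with hK_def
  -- common threshold: `M' = max M ρ₀`
  set M' : ℝ := max M ρ₀ with hM'_def
  have hM' : 0 < M' := lt_max_of_lt_left hM
  have hmono : ∀ {ρ A B : ℝ}, 0 < ρ → 0 < A → A ≤ B →
      T * (ρ / B) ^ (α + 1) ≤ T * (ρ / A) ^ (α + 1) := by
    intro ρ A B hρ hA hAB
    have : ρ / B ≤ ρ / A := div_le_div_of_nonneg_left hρ.le hA hAB
    have hB : 0 ≤ ρ / B := div_nonneg hρ.le (hA.le.trans hAB)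
    gcongr
  refine ⟨c, max c K, M', hc, le_max_left _ _, hM', fun ρ hρ hρle t ht hclose => ⟨?_, ?_⟩⟩
  · exact hlow ρ hρ hρle t ht (hclose.trans (hmono hρ hM (le_max_left _ _)))
  · have hup := localEnergy_le_of_locallySelfSimilar hT hα hρ₀ hsol hreg hss ht hρ hρle
      (hclose.trans (hmono hρ hρ₀ (le_max_right _ _)))
    exact hup.trans (mul_le_mul_of_nonneg_right (le_max_right _ _)
      (Real.rpow_nonneg hρ.le _))

end LocalEnergy

end Literature.Analysis.FluidPDE

end
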